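import Mathlib
import HarnessLib
import Summits.NavierStokesRegularity.NavierStokesRegularity.Theorems.UnthreadedDoorAntidynamoCompositionModuloWall

/-!
# Route `UnthreadedDoor` / `ThreadingFlux`, crux `PoloidalLiouville` (stmt-NavierStokesRegularity-1222), antidynamo v2 skeleton (sha16 `4ebf5683127b`):
# THE WALL `StubScalarLiouville` IS EQUIVALENT TO THE CRUX, BY NAME

Support file (seat leafhand-ns-unthreadeddoor-2 g3, cell decomp-ns), `--supports stmt-NavierStokesRegularity-1222 --as helper`; theorems only.

The composition p793469 gives `StubScalarLiouville → PoloidalLiouville` (both route decls).  The converse is one line: under the crux every slice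
of a flow of the wall's class is a constant field, so `curl v ≡ 0`, i.e. `∇T × (x − x₀) = curl v = 0`.  Hence

* `stubScalarLiouville_of_poloidalLiouville` / `…'` — crux (`ThreadingFlux` / `UnthreadedDoor` decl) ⟹ wall;
* ★ `stubScalarLiouville_iff_poloidalLiouville` / `…'` — WALL ⟺ CRUX.

So the only active registered stub of skeleton `4ebf5683127b` is crux-sized by the kernel (the decomposition «bridge + toroidal potential +
evolution law + wall + irrotational Liouville» is lossless but its wall carries the whole crux).  HONEST LABEL: a by-name certificate; the crux /
wall (= (ML-a) of `…WallCentrePathAnalytic`) is OPEN; nothing here bears on Navier–Stokes regularity; no summit statement is proved. [folklore]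
[cite: KochNadirashviliSereginSverak2009, Thm 5.2 (arXiv:0709.3599 pp. 9–10)]
-/

noncomputable section

-- the summit and its single sub-problem share the name (CONVENTIONS §1)
set_option linter.dupNamespace false

open scoped InnerProductSpace RealInnerProductSpace
open Set Function MeasureTheory
open Literature.Analysis.FluidPDE

namespace Summit.NavierStokesRegularity.NavierStokesRegularity.Theorems.PoloidalLiouville.Antidynamo

/-- **Crux ⟹ wall** (`ThreadingFlux` decl): constant slices are irrotational, and `∇T × (x − x₀)` IS the vorticity. [folklore] -/
theorem stubScalarLiouville_of_poloidalLiouville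
    (hP : Summit.NavierStokesRegularity.NavierStokesRegularity.Theses.ThreadingFlux.PoloidalLiouville) :
    StubScalarLiouville := by
  intro v x₀ T hB hm hsm _hT _hTb hrep _hE t ht x
  -- the flow is unthreaded about `x₀` (a toroidal field is tangent to the spheres about its centre)
  have hun : ∃ x₁ : EuclideanSpace ℝ (Fin 3), ∀ s < 0, ∀ z, inner ℝ (z - x₁) (curl (v s) z) = 0 := by
    refine ⟨x₀, fun s hs z => ?_⟩
    rw [hrep s hs z]
    simp [cross, crossProduct, PiLp.inner_apply, Fin.sum_univ_three]
    ring
  obtain ⟨b, hb⟩ := hP v hB hm hsm hun t ht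
  have hv : v t = fun _ => b := funext hb
  rw [← hrep t ht x, hv]
  simp [curl]

/-- **Crux ⟹ wall** (`UnthreadedDoor` decl, token-identical). [folklore] -/
theorem stubScalarLiouville_of_poloidalLiouville'
    (hP : Summit.NavierStokesRegularity.NavierStokesRegularity.Theses.UnthreadedDoor.PoloidalLiouville) :
    StubScalarLiouville :=
  stubScalarLiouville_of_poloidalLiouville hP

/-- ★ **WALL ⟺ CRUX** (`ThreadingFlux` decl; ⟸ is the landed composition p793469). [folklore] -/
theorem stubScalarLiouville_iff_poloidalLiouville :
    StubScalarLiouville ↔ Summit.NavierStokesRegularity.NavierStokesRegularity.Theses.ThreadingFlux.PoloidalLiouville :=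
  ⟨poloidalLiouville_of_stubScalarLiouville, stubScalarLiouville_of_poloidalLiouville⟩

/-- ★ **WALL ⟺ CRUX** (`UnthreadedDoor` decl). [folklore] -/
theorem stubScalarLiouville_iff_poloidalLiouville' :
    StubScalarLiouville ↔ Summit.NavierStokesRegularity.NavierStokesRegularity.Theses.UnthreadedDoor.PoloidalLiouville :=
  ⟨poloidalLiouville_of_stubScalarLiouville', stubScalarLiouville_of_poloidalLiouville'⟩

end Summit.NavierStokesRegularity.NavierStokesRegularity.Theorems.PoloidalLiouville.Antidynamo

end
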